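import Summits.QuantumFields.BalabanUV.T4Continuum.Support.NE7BalabanSoftOperator
import HarnessLib

/-!
# NE7SoftOperatorQuadraticForm — THE QUADRATIC FORM OF BAŁABAN's SOFT OPERATOR ON OUR CARRIER: `⟪b, softSymOpK b⟫ = hess W (extF b) (extF b) + ‖R(W)(D_W* b)‖² + M⁻²‖Qbar b‖²`
# (squares written as inner products `⟪v, v⟫`; and the same for the mixed-convention `softOpK`), so [B9] Thm 3.11's positivity letter of the ENDs F197∕F199 is EXACTLY the statement «`hess_W(X,X) + ‖R D_W*X‖² +
# M⁻²‖Qbar X‖² > 0` for every non-zero skew periodic `X`» — the Wilson Hessian's quadratic form plus two squares; positivity follows from ANY lower bound of that shape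
# (file 130 of the curved (APE), F201)

Cell `pub-balaban`, rung (B)+1 sub-cell t4, lineage `b2b-balaban-t4-ne7-p1` (CRUX PROVER NE7 #1 = OWNER of row NE7), generation 85; memo
`t4/b2b-balaban-t4-ne7-p1-g85/LAGRANGE-CARRIER.md` §7(ii).  Over F192 `NE7BalabanSoftOperator` (`softOpK_apply`, `softSymOpK_apply`, `inner_hessOpK_left`, `inner_hessSymOpK_left`,
`landauProjK_idem`, `inner_landauProjK_left`) and `NE3EnergyHessBilin` BY NAME.
WHY.  After F198∕F199 the END's positivity letter is «`softSymOpK` positive definite» (print's Thm 3.11 for `Δ_a(U)`).  Whoever discharges it (row NE3's energy road has the tangent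
coercivity and Poincaré pieces at a curved class background) needs the quadratic form written out in the tree's vocabulary: the Hessian quadratic form `hess W X X`, the squared
norm of the projected covariant divergence, and the squared norm of the straight average with the mass `M⁻²`.  THIS file is that identity and the resulting reduction.
WHAT ([folklore]; 0 def, 0 sorry).  §1 `inner_gaugeFixK_self` (`⟪b, D R D* b⟫ = ‖R D* b‖²`), `inner_massK_self` (`= M⁻²‖Qbar b‖²`); §2 **`inner_softSymOpK_self`**, `inner_softOpK_self`
(both `= hess W (extF b) (extF b) (perWin) + ‖R D* b‖² + M⁻²‖Qbar b‖²` — the mixed and symmetric operators have the SAME quadratic form); §3 **`softSymOpK_posDef_of_lowerBound`**: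
positivity from any strictly positive lower bound of the three-term form on non-zero skew forms, and `softSymOpK_posDef_of_coercive` (from `c·⟪b,b⟫ ≤` the form with `c > 0`).
HONEST FRAMING (page 1): algebra; NO estimate; positivity itself is NOT proved here (it is [B9] Thm 3.11 TYPE at a curved background); (KL-B) at curved `W` NOT proved; (APE) on curved
data NOT proved; NOT ONE-STEP, NOT NE7; spine 0∕9; finite T⁴ rung (B)+1 — NOT infinite volume, NOT mass gap, NOT `BetaPertH`, NOT Clay.  Continuum YM on T⁴ ⇐ BetaPertH ∧ nine spine
estimates (0/9 proved); BetaPertH ⇐ (D1) ∧ (D4) ∧ CAP+tail; G-an2-4 gates asym, D1 and NE2/3/4.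
-/

set_option autoImplicit false

open scoped BigOperators InnerProductSpace Matrix Matrix.Norms.L2Operator
open Finset

namespace Summit.QuantumFields.BalabanUV.T4Continuum.NE7SoftOperatorQuadraticForm

open Literature.MathematicalPhysics.QuantumFieldTheory.Balaban1983to89
open B7Prop1Explicit B7Prop2Explicit UnitaryModel
open T4AveragingDeficitWall (IsUnitaryCfg IsSkewDir SmallField)
open T4AveragingDeficitWallBoundary (periodBox IsPeriodicCfg)
open AveragingDeficitMultiLevelPrep (LevelSmall)
open MinimalActionLevels (perWin)
open NE3HessForm (hess)
open NE3HilbertSchmidtTorus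
open NE7BalabanSoftOperator

noncomputable section

variable {d : ℕ} {n : Type*} [Fintype n] [DecidableEq n]

section Carrier

variable [Nonempty n] {L N : ℕ} [NeZero N] (hL : 1 ≤ L) (j : ℕ) [NeZero (N * L ^ (j + 1))]
  {W : Site d → Fin d → (Matrix n n ℂ)ˣ} {x : ℝ} (hWu : IsUnitaryCfg W) (hx : 0 ≤ x) (hs : LevelSmall d L j x) (hWx : SmallField W x)

/-! ## §1 The two squares -/

omit [Nonempty n] [NeZero N] in
/-- **`⟪b, D_W R(W) D_W* b⟫ = ⟪R(W)(D_W* b), R(W)(D_W* b)⟫`** (`R` symmetric and idempotent; written as an inner square). [folklore] -/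
theorem inner_gaugeFixK_self (b : skewForms d n (N * L ^ (j + 1))) :
    ⟪b, gradOpK hWu (N * L ^ (j + 1)) (landauProjK L N (j + 1) W
        ((LinearMap.adjoint (𝕜 := ℝ) (E := skewSecs d n (N * L ^ (j + 1))) (F := skewForms d n (N * L ^ (j + 1))) (gradOpK hWu (N * L ^ (j + 1)))
            : skewForms d n (N * L ^ (j + 1)) →ₗ[ℝ] skewSecs d n (N * L ^ (j + 1))) b))⟫_ℝ
      = ⟪landauProjK L N (j + 1) W
          ((LinearMap.adjoint (𝕜 := ℝ) (E := skewSecs d n (N * L ^ (j + 1))) (F := skewForms d n (N * L ^ (j + 1))) (gradOpK hWu (N * L ^ (j + 1)))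
            : skewForms d n (N * L ^ (j + 1)) →ₗ[ℝ] skewSecs d n (N * L ^ (j + 1))) b),
        landauProjK L N (j + 1) W
          ((LinearMap.adjoint (𝕜 := ℝ) (E := skewSecs d n (N * L ^ (j + 1))) (F := skewForms d n (N * L ^ (j + 1))) (gradOpK hWu (N * L ^ (j + 1)))
            : skewForms d n (N * L ^ (j + 1)) →ₗ[ℝ] skewSecs d n (N * L ^ (j + 1))) b)⟫_ℝ := by
  rw [← LinearMap.adjoint_inner_left (gradOpK hWu (N * L ^ (j + 1)))]
  set a := (LinearMap.adjoint (𝕜 := ℝ) (E := skewSecs d n (N * L ^ (j + 1))) (F := skewForms d n (N * L ^ (j + 1))) (gradOpK hWu (N * L ^ (j + 1)))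
            : skewForms d n (N * L ^ (j + 1)) →ₗ[ℝ] skewSecs d n (N * L ^ (j + 1))) b
  conv_lhs => rw [← landauProjK_idem L N (j + 1) W a]
  rw [inner_landauProjK_left]

/-- **`⟪b, Qbar*(M⁻²•Qbar b)⟫ = M⁻²⟪Qbar b, Qbar b⟫`**. [folklore] -/
theorem inner_massK_self (b : skewForms d n (N * L ^ (j + 1))) :
    ⟪b, (LinearMap.adjoint (𝕜 := ℝ) (E := skewForms d n (N * L ^ (j + 1))) (F := skewForms d n N) (qbarOpK (N := N) hL j hWu hx hs hWx)
              : skewForms d n N →ₗ[ℝ] skewForms d n (N * L ^ (j + 1)))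
            (((((L : ℝ) ^ (j + 1)) ^ 2)⁻¹ • LinearMap.id (R := ℝ) (M := skewForms d n N)) (qbarOpK (N := N) hL j hWu hx hs hWx b))⟫_ℝ
      = (((L : ℝ) ^ (j + 1)) ^ 2)⁻¹ * ⟪qbarOpK (N := N) hL j hWu hx hs hWx b, qbarOpK (N := N) hL j hWu hx hs hWx b⟫_ℝ := by
  rw [LinearMap.adjoint_inner_right, LinearMap.smul_apply, LinearMap.id_apply, real_inner_smul_right]

/-! ## §2 The quadratic forms of the soft operators -/

/-- **THE QUADRATIC FORM OF `softSymOpK`**: `⟪b, softSymOpK b⟫ = hess W (extF b) (extF b) (perWin) + ‖R(W)(D_W* b)‖² + M⁻²‖Qbar b‖²`. [folklore] -/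
theorem inner_softSymOpK_self (b : skewForms d n (N * L ^ (j + 1))) :
    ⟪b, softSymOpK (N := N) hL j hWu hx hs hWx b⟫_ℝ
      = hess W (extF (N * L ^ (j + 1)) (b : Form d n (N * L ^ (j + 1)))) (extF (N * L ^ (j + 1)) (b : Form d n (N * L ^ (j + 1)))) (perWin d (N * L ^ (j + 1)))
        + ⟪landauProjK L N (j + 1) W
            ((LinearMap.adjoint (𝕜 := ℝ) (E := skewSecs d n (N * L ^ (j + 1))) (F := skewForms d n (N * L ^ (j + 1))) (gradOpK hWu (N * L ^ (j + 1)))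
              : skewForms d n (N * L ^ (j + 1)) →ₗ[ℝ] skewSecs d n (N * L ^ (j + 1))) b),
           landauProjK L N (j + 1) W
            ((LinearMap.adjoint (𝕜 := ℝ) (E := skewSecs d n (N * L ^ (j + 1))) (F := skewForms d n (N * L ^ (j + 1))) (gradOpK hWu (N * L ^ (j + 1)))
              : skewForms d n (N * L ^ (j + 1)) →ₗ[ℝ] skewSecs d n (N * L ^ (j + 1))) b)⟫_ℝ
        + (((L : ℝ) ^ (j + 1)) ^ 2)⁻¹ * ⟪qbarOpK (N := N) hL j hWu hx hs hWx b, qbarOpK (N := N) hL j hWu hx hs hWx b⟫_ℝ := by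
  rw [softSymOpK_apply, inner_add_right, inner_add_right, inner_gaugeFixK_self, inner_massK_self, real_inner_comm, inner_hessSymOpK_left]
  congr 1
  congr 1
  ring

/-- **THE QUADRATIC FORM OF `softOpK` IS THE SAME** (the mixed Hessian has the same diagonal). [folklore] -/
theorem inner_softOpK_self (b : skewForms d n (N * L ^ (j + 1))) :
    ⟪b, softOpK (N := N) hL j hWu hx hs hWx b⟫_ℝ
      = hess W (extF (N * L ^ (j + 1)) (b : Form d n (N * L ^ (j + 1)))) (extF (N * L ^ (j + 1)) (b : Form d n (N * L ^ (j + 1)))) (perWin d (N * L ^ (j + 1)))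
        + ⟪landauProjK L N (j + 1) W
            ((LinearMap.adjoint (𝕜 := ℝ) (E := skewSecs d n (N * L ^ (j + 1))) (F := skewForms d n (N * L ^ (j + 1))) (gradOpK hWu (N * L ^ (j + 1)))
              : skewForms d n (N * L ^ (j + 1)) →ₗ[ℝ] skewSecs d n (N * L ^ (j + 1))) b),
           landauProjK L N (j + 1) W
            ((LinearMap.adjoint (𝕜 := ℝ) (E := skewSecs d n (N * L ^ (j + 1))) (F := skewForms d n (N * L ^ (j + 1))) (gradOpK hWu (N * L ^ (j + 1)))
              : skewForms d n (N * L ^ (j + 1)) →ₗ[ℝ] skewSecs d n (N * L ^ (j + 1))) b)⟫_ℝ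
        + (((L : ℝ) ^ (j + 1)) ^ 2)⁻¹ * ⟪qbarOpK (N := N) hL j hWu hx hs hWx b, qbarOpK (N := N) hL j hWu hx hs hWx b⟫_ℝ := by
  rw [softOpK_apply, inner_add_right, inner_add_right, inner_gaugeFixK_self, inner_massK_self, real_inner_comm, inner_hessOpK_left]

/-! ## §3 Positivity from a lower bound of the three-term form -/

/-- **[B9] Thm 3.11's LETTER FROM A LOWER BOUND**: if the three-term form `hess W (extF b) (extF b) + ‖R D* b‖² + M⁻²‖Qbar b‖²` is strictly positive on non-zero skew torus 1-forms,
`softSymOpK` is positive definite (the hypothesis `hpos` of F198∕F199). [folklore] -/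
theorem softSymOpK_posDef_of_lowerBound
    (hlow : ∀ b : skewForms d n (N * L ^ (j + 1)), b ≠ 0 →
      0 < hess W (extF (N * L ^ (j + 1)) (b : Form d n (N * L ^ (j + 1)))) (extF (N * L ^ (j + 1)) (b : Form d n (N * L ^ (j + 1)))) (perWin d (N * L ^ (j + 1)))
        + ⟪landauProjK L N (j + 1) W
            ((LinearMap.adjoint (𝕜 := ℝ) (E := skewSecs d n (N * L ^ (j + 1))) (F := skewForms d n (N * L ^ (j + 1))) (gradOpK hWu (N * L ^ (j + 1)))
              : skewForms d n (N * L ^ (j + 1)) →ₗ[ℝ] skewSecs d n (N * L ^ (j + 1))) b),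
           landauProjK L N (j + 1) W
            ((LinearMap.adjoint (𝕜 := ℝ) (E := skewSecs d n (N * L ^ (j + 1))) (F := skewForms d n (N * L ^ (j + 1))) (gradOpK hWu (N * L ^ (j + 1)))
              : skewForms d n (N * L ^ (j + 1)) →ₗ[ℝ] skewSecs d n (N * L ^ (j + 1))) b)⟫_ℝ
        + (((L : ℝ) ^ (j + 1)) ^ 2)⁻¹ * ⟪qbarOpK (N := N) hL j hWu hx hs hWx b, qbarOpK (N := N) hL j hWu hx hs hWx b⟫_ℝ) :
    ∀ b : skewForms d n (N * L ^ (j + 1)), b ≠ 0 → 0 < ⟪b, softSymOpK (N := N) hL j hWu hx hs hWx b⟫_ℝ := fun b hb => by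
  rw [inner_softSymOpK_self]; exact hlow b hb

/-- **POSITIVITY FROM COERCIVITY**: a bound `c·‖b‖² ≤ hess W (extF b)(extF b) + ‖R D* b‖² + M⁻²‖Qbar b‖²` with `c > 0` (the shape row NE3's energy road produces: tangent coercivity +
Poincaré on the slice, the mass off the slice, the gauge term off the gauge) gives the positivity letter. [folklore] -/
theorem softSymOpK_posDef_of_coercive {c : ℝ} (hc : 0 < c)
    (hcoer : ∀ b : skewForms d n (N * L ^ (j + 1)),
      c * ⟪b, b⟫_ℝ ≤ hess W (extF (N * L ^ (j + 1)) (b : Form d n (N * L ^ (j + 1)))) (extF (N * L ^ (j + 1)) (b : Form d n (N * L ^ (j + 1)))) (perWin d (N * L ^ (j + 1)))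
        + ⟪landauProjK L N (j + 1) W
            ((LinearMap.adjoint (𝕜 := ℝ) (E := skewSecs d n (N * L ^ (j + 1))) (F := skewForms d n (N * L ^ (j + 1))) (gradOpK hWu (N * L ^ (j + 1)))
              : skewForms d n (N * L ^ (j + 1)) →ₗ[ℝ] skewSecs d n (N * L ^ (j + 1))) b),
           landauProjK L N (j + 1) W
            ((LinearMap.adjoint (𝕜 := ℝ) (E := skewSecs d n (N * L ^ (j + 1))) (F := skewForms d n (N * L ^ (j + 1))) (gradOpK hWu (N * L ^ (j + 1)))
              : skewForms d n (N * L ^ (j + 1)) →ₗ[ℝ] skewSecs d n (N * L ^ (j + 1))) b)⟫_ℝ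
        + (((L : ℝ) ^ (j + 1)) ^ 2)⁻¹ * ⟪qbarOpK (N := N) hL j hWu hx hs hWx b, qbarOpK (N := N) hL j hWu hx hs hWx b⟫_ℝ) :
    ∀ b : skewForms d n (N * L ^ (j + 1)), b ≠ 0 → 0 < ⟪b, softSymOpK (N := N) hL j hWu hx hs hWx b⟫_ℝ :=
  softSymOpK_posDef_of_lowerBound hL j hWu hx hs hWx fun b hb =>
    lt_of_lt_of_le (mul_pos hc (real_inner_self_pos.mpr hb)) (hcoer b)

end Carrier

end

end Summit.QuantumFields.BalabanUV.T4Continuum.NE7SoftOperatorQuadraticForm
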